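import Mathlib
import HarnessLib
import HarnessLib.Audit
import Summits.Langlands.Statement
import Summits.Langlands.Langlands.Theses.DescentTypeTrichotomy
import Literature.NumberTheory.Automorphic.AutomorphicRepsGLSatakeFlathProofs
import Summits.Langlands.Langlands.Theses.FaltingsSerreTransfer

/-! BC3 birth skeleton for crux `CertifiedMatching` of the child route FaltingsSerreTransfer (lens-3 g19) — POST-birth form (concludes the ROUTE decl by name).
Line «rank dial»: stub₁ = the crux at n = 2 (first dark rank; doubles as the BC5 plan-only rung), stub₂ = the crux at n ≥ 3; composition `CertifiedMatching_of` is the case split `n = 2 ∨ 3 ≤ n` (omega) — a trivial seam, both stubs genuine and IDEA-NEEDED (neither is the crux reworded: each is a proper sub-box by rank; neither implies PRIM or the summit cheaply, probes_p1).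
SKELETON SHAPE (writer-1 g6 rule, bus L1461): the stubs and the composition `CertifiedMatching_of` conclude statement TEXTS; EXACTLY ONE theorem, `CertifiedMatching_proof`,
concludes the decl by name (`:= CertifiedMatching_of stub₁ stub₂`), so the skeleton audit's by-name candidate is unique and closed modulo the two sorried stubs. -/

set_option linter.unusedVariables false
set_option linter.dupNamespace false

namespace Summit.Langlands.Langlands.Cruxes.CertifiedMatching.Birth

/-- stub₁ (= the BC5 PLAN-ONLY RUNG, tribunal T3): `CertifiedMatching` at n = 2 — the first genuinely dark rank (ρ : Γ_K → GL₂(ℚ̄_ℓ) primitive over a field neither TR nor CM, e.g. T_ℓ of a non-base-change elliptic curve over the −23 cubic field; per (instance, depth): explicit GL₂/K arithmetic cohomology (Gunnells–Yasaki, Koecher reduction) + one Faltings–Serre covering-set computation — INSTRUMENT-only, the stub itself (∀ ρ ∀ B ∀ S′) is never computation-closable (crit-1 row 298 e1); as a ∀-statement IDEA-NEEDED (no potential modularity over any extension of K). Outside S's known regime: PRIM (= S on this box) is open for every n ≥ 2 over such K. -/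
theorem stub_certifiedMatching_rankTwo :
  ∀ (K : Type) [Field K] [NumberField K] (n : ℕ) (hcpt : Literature.NumberTheory.Automorphic.isCompact_glFiniteIntegralLevel n K), 2 ≤ n → n = 2 → ∀ (ℓ : ℕ) [Fact ℓ.Prime] (ι : PadicAlgCl ℓ ≃+* ℂ) (ρ : Literature.NumberTheory.GaloisRepresentations.FramedGaloisRep K (PadicAlgCl ℓ) n), ρ.toGaloisRep.IsIrreducible → ((∀ᶠ v : IsDedekindDomain.HeightOneSpectrum (NumberField.RingOfIntegers K) in Filter.cofinite, ρ.IsUnramifiedAt v) ∧ ∀ (v : IsDedekindDomain.HeightOneSpectrum (NumberField.RingOfIntegers K)) (hv : ((ℓ : ℕ) : NumberField.RingOfIntegers K) ∈ v.asIdeal), (Literature.NumberTheory.PAdicHodge.fontainePstAdicCompletion v ℓ hv).IsDeRhamFramed (ρ.toLocal v)) → (∀ (L : Type) [Field L] [NumberField L] [Algebra K L], (ρ.restrictField L).toGaloisRep.IsIrreducible) → ¬ (∃ (K₀ : Type) (_ : Field K₀) (_ : NumberField K₀) (M : Type) (_ : Field M) (_ : NumberField M) (_ : Algebra K M) (_ :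 Algebra K₀ M), (NumberField.IsTotallyReal K₀ ∨ NumberField.IsCMField K₀) ∧ (∃ (N : Type) (_ : Field N) (_ : NumberField N) (_ : Algebra K N) (_ : Algebra M N) (_ : IsScalarTower K M N), IsGalois K N ∧ IsSolvable (N ≃ₐ[K] N)) ∧ ∃ ρ₀ : Literature.NumberTheory.GaloisRepresentations.FramedGaloisRep K₀ (PadicAlgCl ℓ) n, ρ₀.toGaloisRep.IsIrreducible ∧ ((∀ᶠ v : IsDedekindDomain.HeightOneSpectrum (NumberField.RingOfIntegers K₀) in Filter.cofinite, ρ₀.IsUnramifiedAt v) ∧ ∀ (v : IsDedekindDomain.HeightOneSpectrum (NumberField.RingOfIntegers K₀)) (hv : ((ℓ : ℕ) : NumberField.RingOfIntegers K₀) ∈ v.asIdeal), (Literature.NumberTheory.PAdicHodge.fontainePstAdicCompletion v ℓ hv).IsDeRhamFramed (ρ₀.toLocal v)) ∧ (∀ (L : Type) [Field L] [NumberField L] [Algebra K₀ L], (ρ₀.restrictField L).toGaloisRep.IsIrreducible) ∧ ∀ g : Field.absoluteGaloisGroup M, ∃ c : PadicAlgCl ℓ, c ≠ 0 ∧ Literature.NumberTheory.GaloisRepresentations.FramedRep.charpoly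 (ρ.restrictField M) g = (Literature.NumberTheory.GaloisRepresentations.FramedRep.charpoly (ρ₀.restrictField M) g).scaleRoots c) → ∃ π : Literature.NumberTheory.Automorphic.CuspidalAutomorphicRepData n K hcpt, π.1.IsLAlgebraic ∧ (∀ (B : ℕ) (S' : Set (IsDedekindDomain.HeightOneSpectrum (NumberField.RingOfIntegers K))), S'.Finite → ∃ T : Set (IsDedekindDomain.HeightOneSpectrum (NumberField.RingOfIntegers K)), T.Finite ∧ Disjoint T S' ∧ (∀ (H : Type) [Group H] [Finite H], Nat.card H ≤ B → ∀ φ : Field.absoluteGaloisGroup K →* H, IsOpen (φ.ker : Set (Field.absoluteGaloisGroup K)) → (∀ v : IsDedekindDomain.HeightOneSpectrum (NumberField.RingOfIntegers K), v ∉ S' → ∀ 𝔓 ∈ v.primesAbove, ∀ σ ∈ 𝔓.inertia (Field.absoluteGaloisGroup K), φ σ = 1) → ∀ g : Field.absoluteGaloisGroup K, ∃ v ∈ T, ∃ 𝔓 ∈ v.primesAbove, ∃ σ : Field.absoluteGaloisGroup K, IsArithFrobAt (NumberField.RingOfIntegers K) σ 𝔓 ∧ IsConj (φ σ) (φ g))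 ∧ ∀ v ∈ T, SatakeFrobCompatibleAt ι π.1 ρ v) := by
  sorry

/-- stub₂: `CertifiedMatching` for n ≥ 3 (the generic dark rank; per instance GL_n/K cohomology via Voronoi–Koecher models exists only for tiny levels; IDEA-NEEDED). -/
theorem stub_certifiedMatching_rankGeThree :
  ∀ (K : Type) [Field K] [NumberField K] (n : ℕ) (hcpt : Literature.NumberTheory.Automorphic.isCompact_glFiniteIntegralLevel n K), 2 ≤ n → 3 ≤ n → ∀ (ℓ : ℕ) [Fact ℓ.Prime] (ι : PadicAlgCl ℓ ≃+* ℂ) (ρ : Literature.NumberTheory.GaloisRepresentations.FramedGaloisRep K (PadicAlgCl ℓ) n), ρ.toGaloisRep.IsIrreducible → ((∀ᶠ v : IsDedekindDomain.HeightOneSpectrum (NumberField.RingOfIntegers K) in Filter.cofinite, ρ.IsUnramifiedAt v) ∧ ∀ (v : IsDedekindDomain.HeightOneSpectrum (NumberField.RingOfIntegers K)) (hv : ((ℓ : ℕ) : NumberField.RingOfIntegers K) ∈ v.asIdeal), (Literature.NumberTheory.PAdicHodge.fontainePstAdicCompletion v ℓ hv).IsDeRhamFramed (ρ.toLocal v))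 → (∀ (L : Type) [Field L] [NumberField L] [Algebra K L], (ρ.restrictField L).toGaloisRep.IsIrreducible) → ¬ (∃ (K₀ : Type) (_ : Field K₀) (_ : NumberField K₀) (M : Type) (_ : Field M) (_ : NumberField M) (_ : Algebra K M) (_ : Algebra K₀ M), (NumberField.IsTotallyReal K₀ ∨ NumberField.IsCMField K₀) ∧ (∃ (N : Type) (_ : Field N) (_ : NumberField N) (_ : Algebra K N) (_ : Algebra M N) (_ : IsScalarTower K M N), IsGalois K N ∧ IsSolvable (N ≃ₐ[K] N)) ∧ ∃ ρ₀ : Literature.NumberTheory.GaloisRepresentations.FramedGaloisRep K₀ (PadicAlgCl ℓ) n, ρ₀.toGaloisRep.IsIrreducible ∧ ((∀ᶠ v : IsDedekindDomain.HeightOneSpectrum (NumberField.RingOfIntegers K₀) in Filter.cofinite, ρ₀.IsUnramifiedAt v) ∧ ∀ (v : IsDedekindDomain.HeightOneSpectrum (NumberField.RingOfIntegers K₀)) (hv : ((ℓ : ℕ) : NumberField.RingOfIntegers K₀) ∈ v.asIdeal), (Literature.NumberTheory.PAdicHodge.fontainePstAdicCompletion v ℓ hv).IsDeRhamFramed (ρ₀.toLocal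 v)) ∧ (∀ (L : Type) [Field L] [NumberField L] [Algebra K₀ L], (ρ₀.restrictField L).toGaloisRep.IsIrreducible) ∧ ∀ g : Field.absoluteGaloisGroup M, ∃ c : PadicAlgCl ℓ, c ≠ 0 ∧ Literature.NumberTheory.GaloisRepresentations.FramedRep.charpoly (ρ.restrictField M) g = (Literature.NumberTheory.GaloisRepresentations.FramedRep.charpoly (ρ₀.restrictField M) g).scaleRoots c) → ∃ π : Literature.NumberTheory.Automorphic.CuspidalAutomorphicRepData n K hcpt, π.1.IsLAlgebraic ∧ (∀ (B : ℕ) (S' : Set (IsDedekindDomain.HeightOneSpectrum (NumberField.RingOfIntegers K))), S'.Finite → ∃ T : Set (IsDedekindDomain.HeightOneSpectrum (NumberField.RingOfIntegers K)), T.Finite ∧ Disjoint T S' ∧ (∀ (H : Type) [Group H] [Finite H], Nat.card H ≤ B → ∀ φ : Field.absoluteGaloisGroup K →* H, IsOpen (φ.ker : Set (Field.absoluteGaloisGroup K)) → (∀ v : IsDedekindDomain.HeightOneSpectrum (NumberField.RingOfIntegers K), v ∉ S' → ∀ 𝔓 ∈ v.primesAbove, ∀ σ ∈ 𝔓.inertia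 (Field.absoluteGaloisGroup K), φ σ = 1) → ∀ g : Field.absoluteGaloisGroup K, ∃ v ∈ T, ∃ 𝔓 ∈ v.primesAbove, ∃ σ : Field.absoluteGaloisGroup K, IsArithFrobAt (NumberField.RingOfIntegers K) σ 𝔓 ∧ IsConj (φ σ) (φ g)) ∧ ∀ v ∈ T, SatakeFrobCompatibleAt ι π.1 ρ v) := by
  sorry

/-- composition (kernel-checked, no sorry): stub₁ → stub₂ → the crux TEXT (case split). -/
theorem CertifiedMatching_of
    (h₁ : ∀ (K : Type) [Field K] [NumberField K] (n : ℕ) (hcpt : Literature.NumberTheory.Automorphic.isCompact_glFiniteIntegralLevel n K), 2 ≤ n → n = 2 → ∀ (ℓ : ℕ) [Fact ℓ.Prime] (ι : PadicAlgCl ℓ ≃+* ℂ) (ρ : Literature.NumberTheory.GaloisRepresentations.FramedGaloisRep K (PadicAlgCl ℓ) n), ρ.toGaloisRep.IsIrreducible → ((∀ᶠ v : IsDedekindDomain.HeightOneSpectrum (NumberField.RingOfIntegers K) in Filter.cofinite, ρ.IsUnramifiedAt v) ∧ ∀ (v : IsDedekindDomain.HeightOneSpectrum (NumberField.RingOfIntegers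 K)) (hv : ((ℓ : ℕ) : NumberField.RingOfIntegers K) ∈ v.asIdeal), (Literature.NumberTheory.PAdicHodge.fontainePstAdicCompletion v ℓ hv).IsDeRhamFramed (ρ.toLocal v)) → (∀ (L : Type) [Field L] [NumberField L] [Algebra K L], (ρ.restrictField L).toGaloisRep.IsIrreducible) → ¬ (∃ (K₀ : Type) (_ : Field K₀) (_ : NumberField K₀) (M : Type) (_ : Field M) (_ : NumberField M) (_ : Algebra K M) (_ : Algebra K₀ M), (NumberField.IsTotallyReal K₀ ∨ NumberField.IsCMField K₀) ∧ (∃ (N : Type) (_ : Field N) (_ : NumberField N) (_ : Algebra K N) (_ : Algebra M N) (_ : IsScalarTower K M N), IsGalois K N ∧ IsSolvable (N ≃ₐ[K] N)) ∧ ∃ ρ₀ : Literature.NumberTheory.GaloisRepresentations.FramedGaloisRep K₀ (PadicAlgCl ℓ) n, ρ₀.toGaloisRep.IsIrreducible ∧ ((∀ᶠ v : IsDedekindDomain.HeightOneSpectrum (NumberField.RingOfIntegers K₀) in Filter.cofinite, ρ₀.IsUnramifiedAt v) ∧ ∀ (v : IsDedekindDomain.HeightOneSpectrum (NumberField.RingOfIntegers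 K₀)) (hv : ((ℓ : ℕ) : NumberField.RingOfIntegers K₀) ∈ v.asIdeal), (Literature.NumberTheory.PAdicHodge.fontainePstAdicCompletion v ℓ hv).IsDeRhamFramed (ρ₀.toLocal v)) ∧ (∀ (L : Type) [Field L] [NumberField L] [Algebra K₀ L], (ρ₀.restrictField L).toGaloisRep.IsIrreducible) ∧ ∀ g : Field.absoluteGaloisGroup M, ∃ c : PadicAlgCl ℓ, c ≠ 0 ∧ Literature.NumberTheory.GaloisRepresentations.FramedRep.charpoly (ρ.restrictField M) g = (Literature.NumberTheory.GaloisRepresentations.FramedRep.charpoly (ρ₀.restrictField M) g).scaleRoots c) → ∃ π : Literature.NumberTheory.Automorphic.CuspidalAutomorphicRepData n K hcpt, π.1.IsLAlgebraic ∧ (∀ (B : ℕ) (S' : Set (IsDedekindDomain.HeightOneSpectrum (NumberField.RingOfIntegers K))), S'.Finite → ∃ T : Set (IsDedekindDomain.HeightOneSpectrum (NumberField.RingOfIntegers K)), T.Finite ∧ Disjoint T S' ∧ (∀ (H : Type) [Group H] [Finite H], Nat.card H ≤ B → ∀ φ : Field.absoluteGaloisGroup K →* H, IsOpen (φ.ker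 : Set (Field.absoluteGaloisGroup K)) → (∀ v : IsDedekindDomain.HeightOneSpectrum (NumberField.RingOfIntegers K), v ∉ S' → ∀ 𝔓 ∈ v.primesAbove, ∀ σ ∈ 𝔓.inertia (Field.absoluteGaloisGroup K), φ σ = 1) → ∀ g : Field.absoluteGaloisGroup K, ∃ v ∈ T, ∃ 𝔓 ∈ v.primesAbove, ∃ σ : Field.absoluteGaloisGroup K, IsArithFrobAt (NumberField.RingOfIntegers K) σ 𝔓 ∧ IsConj (φ σ) (φ g)) ∧ ∀ v ∈ T, SatakeFrobCompatibleAt ι π.1 ρ v))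
    (h₂ : ∀ (K : Type) [Field K] [NumberField K] (n : ℕ) (hcpt : Literature.NumberTheory.Automorphic.isCompact_glFiniteIntegralLevel n K), 2 ≤ n → 3 ≤ n → ∀ (ℓ : ℕ) [Fact ℓ.Prime] (ι : PadicAlgCl ℓ ≃+* ℂ) (ρ : Literature.NumberTheory.GaloisRepresentations.FramedGaloisRep K (PadicAlgCl ℓ) n), ρ.toGaloisRep.IsIrreducible → ((∀ᶠ v : IsDedekindDomain.HeightOneSpectrum (NumberField.RingOfIntegers K) in Filter.cofinite, ρ.IsUnramifiedAt v) ∧ ∀ (v : IsDedekindDomain.HeightOneSpectrum (NumberField.RingOfIntegers K)) (hv : ((ℓ : ℕ) : NumberField.RingOfIntegers K) ∈ v.asIdeal), (Literature.NumberTheory.PAdicHodge.fontainePstAdicCompletion v ℓ hv).IsDeRhamFramed (ρ.toLocal v)) → (∀ (L : Type) [Field L] [NumberField L] [Algebra K L], (ρ.restrictField L).toGaloisRep.IsIrreducible) → ¬ (∃ (K₀ : Type) (_ : Field K₀) (_ : NumberField K₀) (M : Type) (_ : Field M) (_ : NumberField M) (_ : Algebra K M) (_ : Algebra K₀ M), (NumberField.IsTotallyReal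 K₀ ∨ NumberField.IsCMField K₀) ∧ (∃ (N : Type) (_ : Field N) (_ : NumberField N) (_ : Algebra K N) (_ : Algebra M N) (_ : IsScalarTower K M N), IsGalois K N ∧ IsSolvable (N ≃ₐ[K] N)) ∧ ∃ ρ₀ : Literature.NumberTheory.GaloisRepresentations.FramedGaloisRep K₀ (PadicAlgCl ℓ) n, ρ₀.toGaloisRep.IsIrreducible ∧ ((∀ᶠ v : IsDedekindDomain.HeightOneSpectrum (NumberField.RingOfIntegers K₀) in Filter.cofinite, ρ₀.IsUnramifiedAt v) ∧ ∀ (v : IsDedekindDomain.HeightOneSpectrum (NumberField.RingOfIntegers K₀)) (hv : ((ℓ : ℕ) : NumberField.RingOfIntegers K₀) ∈ v.asIdeal), (Literature.NumberTheory.PAdicHodge.fontainePstAdicCompletion v ℓ hv).IsDeRhamFramed (ρ₀.toLocal v)) ∧ (∀ (L : Type) [Field L] [NumberField L] [Algebra K₀ L], (ρ₀.restrictField L).toGaloisRep.IsIrreducible) ∧ ∀ g : Field.absoluteGaloisGroup M, ∃ c : PadicAlgCl ℓ, c ≠ 0 ∧ Literature.NumberTheory.GaloisRepresentations.FramedRep.charpoly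 (ρ.restrictField M) g = (Literature.NumberTheory.GaloisRepresentations.FramedRep.charpoly (ρ₀.restrictField M) g).scaleRoots c) → ∃ π : Literature.NumberTheory.Automorphic.CuspidalAutomorphicRepData n K hcpt, π.1.IsLAlgebraic ∧ (∀ (B : ℕ) (S' : Set (IsDedekindDomain.HeightOneSpectrum (NumberField.RingOfIntegers K))), S'.Finite → ∃ T : Set (IsDedekindDomain.HeightOneSpectrum (NumberField.RingOfIntegers K)), T.Finite ∧ Disjoint T S' ∧ (∀ (H : Type) [Group H] [Finite H], Nat.card H ≤ B → ∀ φ : Field.absoluteGaloisGroup K →* H, IsOpen (φ.ker : Set (Field.absoluteGaloisGroup K)) → (∀ v : IsDedekindDomain.HeightOneSpectrum (NumberField.RingOfIntegers K), v ∉ S' → ∀ 𝔓 ∈ v.primesAbove, ∀ σ ∈ 𝔓.inertia (Field.absoluteGaloisGroup K), φ σ = 1) → ∀ g : Field.absoluteGaloisGroup K, ∃ v ∈ T, ∃ 𝔓 ∈ v.primesAbove, ∃ σ : Field.absoluteGaloisGroup K, IsArithFrobAt (NumberField.RingOfIntegers K) σ 𝔓 ∧ IsConj (φ σ) (φ g))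 ∧ ∀ v ∈ T, SatakeFrobCompatibleAt ι π.1 ρ v)) :
    ∀ (K : Type) [Field K] [NumberField K] (n : ℕ) (hcpt : Literature.NumberTheory.Automorphic.isCompact_glFiniteIntegralLevel n K), 2 ≤ n → ∀ (ℓ : ℕ) [Fact ℓ.Prime] (ι : PadicAlgCl ℓ ≃+* ℂ) (ρ : Literature.NumberTheory.GaloisRepresentations.FramedGaloisRep K (PadicAlgCl ℓ) n), ρ.toGaloisRep.IsIrreducible → ((∀ᶠ v : IsDedekindDomain.HeightOneSpectrum (NumberField.RingOfIntegers K) in Filter.cofinite, ρ.IsUnramifiedAt v) ∧ ∀ (v : IsDedekindDomain.HeightOneSpectrum (NumberField.RingOfIntegers K)) (hv : ((ℓ : ℕ) : NumberField.RingOfIntegers K) ∈ v.asIdeal), (Literature.NumberTheory.PAdicHodge.fontainePstAdicCompletion v ℓ hv).IsDeRhamFramed (ρ.toLocal v)) → (∀ (L : Type) [Field L] [NumberField L] [Algebra K L], (ρ.restrictField L).toGaloisRep.IsIrreducible) → ¬ (∃ (K₀ : Type) (_ : Field K₀) (_ : NumberField K₀) (M : Type) (_ : Field M) (_ : NumberField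 M) (_ : Algebra K M) (_ : Algebra K₀ M), (NumberField.IsTotallyReal K₀ ∨ NumberField.IsCMField K₀) ∧ (∃ (N : Type) (_ : Field N) (_ : NumberField N) (_ : Algebra K N) (_ : Algebra M N) (_ : IsScalarTower K M N), IsGalois K N ∧ IsSolvable (N ≃ₐ[K] N)) ∧ ∃ ρ₀ : Literature.NumberTheory.GaloisRepresentations.FramedGaloisRep K₀ (PadicAlgCl ℓ) n, ρ₀.toGaloisRep.IsIrreducible ∧ ((∀ᶠ v : IsDedekindDomain.HeightOneSpectrum (NumberField.RingOfIntegers K₀) in Filter.cofinite, ρ₀.IsUnramifiedAt v) ∧ ∀ (v : IsDedekindDomain.HeightOneSpectrum (NumberField.RingOfIntegers K₀)) (hv : ((ℓ : ℕ) : NumberField.RingOfIntegers K₀) ∈ v.asIdeal), (Literature.NumberTheory.PAdicHodge.fontainePstAdicCompletion v ℓ hv).IsDeRhamFramed (ρ₀.toLocal v)) ∧ (∀ (L : Type) [Field L] [NumberField L] [Algebra K₀ L], (ρ₀.restrictField L).toGaloisRep.IsIrreducible) ∧ ∀ g : Field.absoluteGaloisGroup M, ∃ c : PadicAlgCl ℓ,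 c ≠ 0 ∧ Literature.NumberTheory.GaloisRepresentations.FramedRep.charpoly (ρ.restrictField M) g = (Literature.NumberTheory.GaloisRepresentations.FramedRep.charpoly (ρ₀.restrictField M) g).scaleRoots c) → ∃ π : Literature.NumberTheory.Automorphic.CuspidalAutomorphicRepData n K hcpt, π.1.IsLAlgebraic ∧ (∀ (B : ℕ) (S' : Set (IsDedekindDomain.HeightOneSpectrum (NumberField.RingOfIntegers K))), S'.Finite → ∃ T : Set (IsDedekindDomain.HeightOneSpectrum (NumberField.RingOfIntegers K)), T.Finite ∧ Disjoint T S' ∧ (∀ (H : Type) [Group H] [Finite H], Nat.card H ≤ B → ∀ φ : Field.absoluteGaloisGroup K →* H, IsOpen (φ.ker : Set (Field.absoluteGaloisGroup K)) → (∀ v : IsDedekindDomain.HeightOneSpectrum (NumberField.RingOfIntegers K), v ∉ S' → ∀ 𝔓 ∈ v.primesAbove, ∀ σ ∈ 𝔓.inertia (Field.absoluteGaloisGroup K), φ σ = 1) → ∀ g : Field.absoluteGaloisGroup K, ∃ v ∈ T, ∃ 𝔓 ∈ v.primesAbove, ∃ σ : Field.absoluteGaloisGroup K, IsArithFrobAt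 (NumberField.RingOfIntegers K) σ 𝔓 ∧ IsConj (φ σ) (φ g)) ∧ ∀ v ∈ T, SatakeFrobCompatibleAt ι π.1 ρ v) := by
  intro K _ _ n hcpt hn
  rcases Nat.lt_or_ge n 3 with hlt | hge
  · exact h₁ K n hcpt hn (by omega)
  · exact h₂ K n hcpt hn hge

/-- the ONE closed theorem concluding the decl by name. -/
theorem CertifiedMatching_proof : Summit.Langlands.Langlands.Theses.FaltingsSerreTransfer.CertifiedMatching :=
  CertifiedMatching_of stub_certifiedMatching_rankTwo stub_certifiedMatching_rankGeThree

end Summit.Langlands.Langlands.Cruxes.CertifiedMatching.Birth
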